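import Summits.CriticalPhenomena.PercolationContinuityZ3.Theorems.Transplant.PlanarSkeletonFrmQuasiDefs
import Summits.CriticalPhenomena.PercolationContinuityZ3.Theorems.Transplant.SkelFrmQuasiBChoiceNums
import Summits.CriticalPhenomena.PercolationContinuityZ3.Theorems.Transplant.SkelFrmBChoiceNums
import Summits.CriticalPhenomena.PercolationContinuityZ3.Theorems.Transplant.SkelFrmQuasiBParamsFaceFloorsTXAR0
import Summits.CriticalPhenomena.PercolationContinuityZ3.Theorems.Transplant.SkelFrmBParamsFaceFloorsTXAR0
import Summits.CriticalPhenomena.PercolationContinuityZ3.Theorems.Transplant.SkelFrmQuasiBParamsFaceFloorsAXA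
import Summits.CriticalPhenomena.PercolationContinuityZ3.Theorems.Transplant.SkelFrmBParamsFaceFloorsAXA
import Summits.CriticalPhenomena.PercolationContinuityZ3.Theorems.Transplant.SkelNegBParamsFaceFloorsAXA
import Summits.CriticalPhenomena.PercolationContinuityZ3.Theorems.Transplant.SkelNegBParamsRootArith
import Summits.CriticalPhenomena.PercolationContinuityZ3.Theorems.Transplant.SkelFrmQuasi1ChoiceDefs
import Summits.CriticalPhenomena.PercolationContinuityZ3.Theorems.Transplant.SkelFrmQuasi1ParamsLBL
import Summits.CriticalPhenomena.PercolationContinuityZ3.Theorems.Transplant.SkelFrmQuasiBParamsFaceUnits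
import Summits.CriticalPhenomena.PercolationContinuityZ3.Theorems.Transplant.SkelFrmQuasiBParamsLF
import Summits.CriticalPhenomena.PercolationContinuityZ3.Theorems.Transplant.SkelFrmQuasiBParamsLFA
import HarnessLib
import Summits.CriticalPhenomena.PercolationContinuityZ3.Theorems.Transplant.SkelFrmBParamsFaceFloorsAXAR0
/-!
# GEN-Q PORT (WAVE-Q table v0.8 section 2, row G168, U-level L18; captain R-6/R-7 2026-08-27: carrier token swap `PlanarSkeletonFrmFrom ↦ PlanarSkeletonFrmQuasi`)
# of the tree module «Transplant/SkelFrmFromBParamsFaceFloorsAXAR0» (sha256 109db277a8a4bbc2…) onto the quasi-step carrier `PlanarSkeletonFrmQuasi` (p507026): «SkelFrmQuasiBParamsFaceFloorsAXAR0»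

HAND HUNK (L-FLOORMAP-1 ①⑥ / L-KitS-1 reader side; G017 «SkelFrmQuasiBChoiceNums», hp-8's KitSN): KS0.R'0→KS0.R'0N×34 — the kit of record at window cost `KS.NQ Φ`.

ORIGINAL TITLE: N2 (frames-only node `SamePDropOfSkeletonFrmFrom₁`, OPEN) params column over `PlanarSkeletonFrm` — (ζ″) ledger, shape (B′) — **J19 / R0 SUCCESSOR (lead g12 08:47:30Z: ONE kit radius `KS0.R'0` in N2's (F) layer)** of the RA′ twin; every decl renamed `…R0`, `KS.RA' ↦ KS0.R'0` (the floors were already hypo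

builds on p205010 (kernel theorem, internal audit signed; external expert review pending) — nothing in this file uses p205010; NOTHING is claimed about any open node
((N3-b), the end state).  Lane `prim-bschramm`, seat `prim-bschramm-stmt` (gen 33; GEN-Q column pen; tool = captain gen-1 g4's port_genq.py R-14 --cone + p3-g30's T1 patch).  Helper file (`--supports stmt-CriticalPhenomena-4575 --as helper`).
PORT RULES (U-wave r1–r4 re-used, GEN-Q hunk classes of p3-g29 #6136): declaration order, names and proof texts are those of «SkelFrmFromBParamsFaceFloorsAXAR0», byte-identical except
(i) the carrier token `PlanarSkeletonFrmFrom ↦ PlanarSkeletonFrmQuasi` in binders, `namespace`/`end` lines and qualified names (module names `SkelFrmFrom… ↦ SkelFrmQuasi…`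
in imports of already-ported rows); (ii) `Φ.step ↦ Φ.qstep` with the called Steps lemma replaced by its `…Q`/`_q` twin and the cost `Φ.M` threaded (none in this file unless
listed below); (iii) `Φ.cyl_connected ↦ Φ.cyl_reach` readers (none unless listed); (iv) graph-ball radii / window floors ×`Φ.M` (none unless listed).  Carrier-free
residents stay imported/exported from the original «SkelFrmBParamsFaceFloorsAXAR0» exactly as in the FrmFrom port.  Docstrings and citations are the original's.

-/

noncomputable section

open scoped Classical

namespace Summit.CriticalPhenomena.PercolationContinuityZ3.Theorems.Transplant

namespace PlanarSkeletonFrmQuasi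

namespace NegB

open Literature.Probability.Percolation Literature.Probability.LatticeModels SimpleGraph
open SkelConc (Consts)
open Skelφ (shearUnit xBoxB xBoxLoA xBoxHiA)
open Skelφ.StepI (DataN)
open TwoAxis.Para (modulus)
open Neg

namespace KS

section FloorsAX

-- `FcA_abs_le` (radius-free) is USED from the landed RA′ module `SkelFrmBParamsFaceFloorsAXA` (J19 rule: untouched decls are never re-declared).

export PlanarSkeletonNeg.NegB.KS (xBoxA_bounds)

/-- **`FX1` at the (ζ′) x-face tuple** (`σ = 1`; the near end of region `k` above `flo`). [cite: KozmaNitzan2024, §4 Lemma 12 (pp. 23–25)] -/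
theorem FX1_XAR0 (κ : Consts) {V : Type} [DecidableEq V] [Countable V] {G : SimpleGraph V} [G.LocallyFinite] (Φ : PlanarSkeletonFrmQuasi G) (t : V) (p : unitInterval) (D : Skelφ.StepI.DataNS V) (g : ℕ) (f : ℕ) (mk : ℕ) (hN : EqNumL κ Φ t p D g f) (hκ : (hL κ Φ t p D g f).natAbs ≤ 10 * nL κ Φ t p D g f)
    (hnA : 2000 * Neg.Kq κ * (KS0.R'0N κ Φ (KS.NQ Φ) t p D mk + 2) ≤ nL κ Φ t p D g f) (hℓ : 22000 * Neg.Kq κ * (KS0.R'0N κ Φ (KS.NQ Φ) t p D mk + 2) ≤ ℓL κ Φ t p D g f)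
    (hs0 : 6 * (KS0.R'0N κ Φ (KS.NQ Φ) t p D mk : ℤ) + 11 ≤ u₀A κ Φ t p D g f) (yL : Site 2)
    (hΛ₀ : |Λ₀of κ Φ t p D g f yL| ≤ 3 * modulus (nL κ Φ t p D g f) (hL κ Φ t p D g f) (vL κ Φ t p D g f) (vβL κ Φ t p D g f))
    {qB : ℕ} (hq : 4 * qB ≤ nL κ Φ t p D g f) {lev E : ℤ} {j : ℕ} (hE : E ≤ 2 * (KS0.R'0N κ Φ (KS.NQ Φ) t p D mk : ℤ))
    (hlev : 5 * ((fcellsA κ Φ t p D g f).r 0 : ℤ) + 10 * u₀A κ Φ t p D g f * ((j : ℤ) + 1) - 1 - E ≤ lev)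
    {k : ℕ} (hk : k + 1 ≤ 1000 * Neg.Kq κ) :
    (nL κ Φ t p D g f : ℤ) * modulus (nL κ Φ t p D g f) (hL κ Φ t p D g f) (vL κ Φ t p D g f) (vβL κ Φ t p D g f) *
        ((5 * ((fcellsA κ Φ t p D g f).r 0 : ℤ) + 10 * u₀A κ Φ t p D g f * (j : ℤ) + 3 - lev) - FcA κ Φ t p D g f yL) ≤
      u₀A κ Φ t p D g f * modulus (nL κ Φ t p D g f) (hL κ Φ t p D g f) (vL κ Φ t p D g f) (vβL κ Φ t p D g f) * xBoxLoA (nL κ Φ t p D g f) qB (KS0.R'0N κ Φ (KS.NQ Φ) t p D mk) k -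
        u₀A κ Φ t p D g f * (nL κ Φ t p D g f : ℤ) * (shearUnit (nL κ Φ t p D g f) (hL κ Φ t p D g f) : ℤ) *
          (xBoxB (nL κ Φ t p D g f) (ℓL κ Φ t p D g f) (hL κ Φ t p D g f) (KS0.R'0N κ Φ (KS.NQ Φ) t p D mk) k + 1) -
        u₀A κ Φ t p D g f * (nL κ Φ t p D g f : ℤ) - (nL κ Φ t p D g f : ℤ) * modulus (nL κ Φ t p D g f) (hL κ Φ t p D g f) (vL κ Φ t p D g f) (vβL κ Φ t p D g f) := by
  obtain ⟨hn1, hℓ1⟩ := one_le_of_eqNumL κ Φ t p D g f hN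
  have hm0 : 0 < modulus (nL κ Φ t p D g f) (hL κ Φ t p D g f) (vL κ Φ t p D g f) (vβL κ Φ t p D g f) := Skelφ.NegPrm.modulus_vβOf_pos hn1 hℓ1 _ _
  have hu : 1 ≤ u₀A κ Φ t p D g f := (units_eqA κ Φ t p D g f).2.2.2.2.1
  have hn : (1 : ℤ) ≤ (nL κ Φ t p D g f : ℤ) := by exact_mod_cast hn1
  obtain ⟨hFlo, -⟩ := FcA_abs_le κ Φ t p D g f hN yL hΛ₀
  have hsl := slant_leR0 κ Φ t p D g f mk hN hκ hℓ hk (mul_nonneg (by linarith : 0 ≤ u₀A κ Φ t p D g f) (by linarith : (0:ℤ) ≤ (nL κ Φ t p D g f : ℤ)))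
  have hnA' : 2000 * (Neg.Kq κ : ℤ) * ((KS0.R'0N κ Φ (KS.NQ Φ) t p D mk : ℤ) + 2) ≤ (nL κ Φ t p D g f : ℤ) := by exact_mod_cast hnA
  have hq' : 4 * (qB : ℤ) ≤ (nL κ Φ t p D g f : ℤ) := by exact_mod_cast hq
  have hKq : (1 : ℤ) ≤ (Neg.Kq κ : ℤ) := by exact_mod_cast Neg.one_le_Kq κ
  have hR0 : (0 : ℤ) ≤ (KS0.R'0N κ Φ (KS.NQ Φ) t p D mk : ℤ) := Nat.cast_nonneg _
  have hQR : (KS0.R'0N κ Φ (KS.NQ Φ) t p D mk : ℤ) ≤ (Neg.Kq κ : ℤ) * (KS0.R'0N κ Φ (KS.NQ Φ) t p D mk : ℤ) := le_mul_of_one_le_left hR0 hKq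
  have hRn : KS0.R'0N κ Φ (KS.NQ Φ) t p D mk ≤ nL κ Φ t p D g f := by
    have : KS0.R'0N κ Φ (KS.NQ Φ) t p D mk ≤ 2000 * Neg.Kq κ * (KS0.R'0N κ Φ (KS.NQ Φ) t p D mk + 2) := by
      have := Neg.one_le_Kq κ; nlinarith
    omega
  obtain ⟨hLo, -⟩ := xBoxA_bounds (qB := qB) hRn k
  have hm2000 : (2000 : ℤ) ≤ modulus (nL κ Φ t p D g f) (hL κ Φ t p D g f) (vL κ Φ t p D g f) (vβL κ Φ t p D g f) := by
    have hm := (Skelφ.NegPrm.modulus_vβOf hn1 (hL κ Φ t p D g f) (ℓL κ Φ t p D g f) (vL κ Φ t p D g f)).1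
    have e : vβL κ Φ t p D g f = Skelφ.NegPrm.vβOf (nL κ Φ t p D g f) (hL κ Φ t p D g f) (ℓL κ Φ t p D g f) (vL κ Φ t p D g f) := rfl
    rw [← e] at hm
    have hℓ' : 22000 * (Neg.Kq κ : ℤ) * ((KS0.R'0N κ Φ (KS.NQ Φ) t p D mk : ℤ) + 2) ≤ (ℓL κ Φ t p D g f : ℤ) := by exact_mod_cast hℓ
    have hKR : (0 : ℤ) ≤ (Neg.Kq κ : ℤ) * (KS0.R'0N κ Φ (KS.NQ Φ) t p D mk : ℤ) := mul_nonneg (by linarith) hR0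
    have h1 : (1 : ℤ) * ((ℓL κ Φ t p D g f : ℤ) - 1) ≤ (nL κ Φ t p D g f : ℤ) * ((ℓL κ Φ t p D g f : ℤ) - 1) :=
      mul_le_mul_of_nonneg_right hn (by linarith)
    linarith
  clear hnA hq hk hℓ hκ hΛ₀
  set n : ℤ := (nL κ Φ t p D g f : ℤ)
  set m := modulus (nL κ Φ t p D g f) (hL κ Φ t p D g f) (vL κ Φ t p D g f) (vβL κ Φ t p D g f)
  set u := u₀A κ Φ t p D g f
  set F := FcA κ Φ t p D g f yL
  set R : ℤ := (KS0.R'0N κ Φ (KS.NQ Φ) t p D mk : ℤ)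
  set Q : ℤ := (Neg.Kq κ : ℤ)
  set L := xBoxLoA (nL κ Φ t p D g f) qB (KS0.R'0N κ Φ (KS.NQ Φ) t p D mk) k
  set S := (shearUnit (nL κ Φ t p D g f) (hL κ Φ t p D g f) : ℤ) * (xBoxB (nL κ Φ t p D g f) (ℓL κ Φ t p D g f) (hL κ Φ t p D g f) (KS0.R'0N κ Φ (KS.NQ Φ) t p D mk) k + 1)
  set r : ℤ := ((fcellsA κ Φ t p D g f).r 0 : ℤ)
  have hnm : 0 < n * m := mul_pos (by linarith) hm0
  have hum : 0 ≤ u * m := mul_nonneg (by linarith) hm0.le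
  -- products
  have p1 : n * m * ((5 * r + 10 * u * (j : ℤ) + 3 - lev) - F) ≤ n * m * (4 - 10 * u + E + 3 * u) := by
    refine mul_le_mul_of_nonneg_left ?_ hnm.le
    have : 10 * u * ((j : ℤ) + 1) = 10 * u * (j : ℤ) + 10 * u := by ring
    linarith
  have p2 : u * m * (-((qB : ℤ) + R + n)) ≤ u * m * L := mul_le_mul_of_nonneg_left hLo hum
  have p3 : n * m * E ≤ n * m * (2 * R) := mul_le_mul_of_nonneg_left hE hnm.le
  have p4 : n * m * (6 * R + 11) ≤ n * m * u := mul_le_mul_of_nonneg_left hs0 hnm.le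
  have p5 : u * m * (4 * (qB : ℤ)) ≤ u * m * n := mul_le_mul_of_nonneg_left hq' hum
  have p6 : u * m * (2000 * R) ≤ u * m * n := mul_le_mul_of_nonneg_left (by nlinarith) hum
  have p7 : u * n * 2000 ≤ u * n * m := mul_le_mul_of_nonneg_left hm2000 (mul_nonneg (by linarith) (by linarith))
  nlinarith [p1, p2, p3, p4, p5, p6, p7, hsl, hnm, hum]

/-- **`FX3` at the (ζ′) x-face tuple** (`σ = −1`; mirror of `FX1`). [cite: KozmaNitzan2024, §4 Lemma 12 (pp. 23–25)] -/
theorem FX3_XAR0 (κ : Consts) {V : Type} [DecidableEq V] [Countable V] {G : SimpleGraph V} [G.LocallyFinite] (Φ : PlanarSkeletonFrmQuasi G) (t : V) (p : unitInterval) (D : Skelφ.StepI.DataNS V) (g : ℕ) (f : ℕ) (mk : ℕ) (hN : EqNumL κ Φ t p D g f) (hκ : (hL κ Φ t p D g f).natAbs ≤ 10 * nL κ Φ t p D g f)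
    (hnA : 2000 * Neg.Kq κ * (KS0.R'0N κ Φ (KS.NQ Φ) t p D mk + 2) ≤ nL κ Φ t p D g f) (hℓ : 22000 * Neg.Kq κ * (KS0.R'0N κ Φ (KS.NQ Φ) t p D mk + 2) ≤ ℓL κ Φ t p D g f)
    (hs0 : 6 * (KS0.R'0N κ Φ (KS.NQ Φ) t p D mk : ℤ) + 11 ≤ u₀A κ Φ t p D g f) (yL : Site 2)
    (hΛ₀ : |Λ₀of κ Φ t p D g f yL| ≤ 3 * modulus (nL κ Φ t p D g f) (hL κ Φ t p D g f) (vL κ Φ t p D g f) (vβL κ Φ t p D g f))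
    {qB : ℕ} (hq : 4 * qB ≤ nL κ Φ t p D g f) {lev E : ℤ} {j : ℕ} (hE : E ≤ 2 * (KS0.R'0N κ Φ (KS.NQ Φ) t p D mk : ℤ))
    (hlev : 5 * ((fcellsA κ Φ t p D g f).r 0 : ℤ) + 10 * u₀A κ Φ t p D g f * ((j : ℤ) + 1) - 1 - E ≤ lev)
    {k : ℕ} (hk : k + 1 ≤ 1000 * Neg.Kq κ) :
    (nL κ Φ t p D g f : ℤ) * modulus (nL κ Φ t p D g f) (hL κ Φ t p D g f) (vL κ Φ t p D g f) (vβL κ Φ t p D g f) *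
        ((5 * ((fcellsA κ Φ t p D g f).r 0 : ℤ) + 10 * u₀A κ Φ t p D g f * (j : ℤ) + 3 - lev) + FcA κ Φ t p D g f yL + 1) ≤
      u₀A κ Φ t p D g f * modulus (nL κ Φ t p D g f) (hL κ Φ t p D g f) (vL κ Φ t p D g f) (vβL κ Φ t p D g f) * xBoxLoA (nL κ Φ t p D g f) qB (KS0.R'0N κ Φ (KS.NQ Φ) t p D mk) k -
        u₀A κ Φ t p D g f * (nL κ Φ t p D g f : ℤ) * (shearUnit (nL κ Φ t p D g f) (hL κ Φ t p D g f) : ℤ) *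
          (xBoxB (nL κ Φ t p D g f) (ℓL κ Φ t p D g f) (hL κ Φ t p D g f) (KS0.R'0N κ Φ (KS.NQ Φ) t p D mk) k + 1) := by
  obtain ⟨hn1, hℓ1⟩ := one_le_of_eqNumL κ Φ t p D g f hN
  have hm0 : 0 < modulus (nL κ Φ t p D g f) (hL κ Φ t p D g f) (vL κ Φ t p D g f) (vβL κ Φ t p D g f) := Skelφ.NegPrm.modulus_vβOf_pos hn1 hℓ1 _ _
  have hu : 1 ≤ u₀A κ Φ t p D g f := (units_eqA κ Φ t p D g f).2.2.2.2.1
  have hn : (1 : ℤ) ≤ (nL κ Φ t p D g f : ℤ) := by exact_mod_cast hn1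
  obtain ⟨-, hFhi⟩ := FcA_abs_le κ Φ t p D g f hN yL hΛ₀
  have hsl := slant_leR0 κ Φ t p D g f mk hN hκ hℓ hk (mul_nonneg (by linarith : 0 ≤ u₀A κ Φ t p D g f) (by linarith : (0:ℤ) ≤ (nL κ Φ t p D g f : ℤ)))
  have hnA' : 2000 * (Neg.Kq κ : ℤ) * ((KS0.R'0N κ Φ (KS.NQ Φ) t p D mk : ℤ) + 2) ≤ (nL κ Φ t p D g f : ℤ) := by exact_mod_cast hnA
  have hq' : 4 * (qB : ℤ) ≤ (nL κ Φ t p D g f : ℤ) := by exact_mod_cast hq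
  have hKq : (1 : ℤ) ≤ (Neg.Kq κ : ℤ) := by exact_mod_cast Neg.one_le_Kq κ
  have hR0 : (0 : ℤ) ≤ (KS0.R'0N κ Φ (KS.NQ Φ) t p D mk : ℤ) := Nat.cast_nonneg _
  have hQR : (KS0.R'0N κ Φ (KS.NQ Φ) t p D mk : ℤ) ≤ (Neg.Kq κ : ℤ) * (KS0.R'0N κ Φ (KS.NQ Φ) t p D mk : ℤ) := le_mul_of_one_le_left hR0 hKq
  have hRn : KS0.R'0N κ Φ (KS.NQ Φ) t p D mk ≤ nL κ Φ t p D g f := by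
    have : KS0.R'0N κ Φ (KS.NQ Φ) t p D mk ≤ 2000 * Neg.Kq κ * (KS0.R'0N κ Φ (KS.NQ Φ) t p D mk + 2) := by
      have := Neg.one_le_Kq κ; nlinarith
    omega
  obtain ⟨hLo, -⟩ := xBoxA_bounds (qB := qB) hRn k
  clear hnA hq hk hℓ hκ hΛ₀
  set n : ℤ := (nL κ Φ t p D g f : ℤ)
  set m := modulus (nL κ Φ t p D g f) (hL κ Φ t p D g f) (vL κ Φ t p D g f) (vβL κ Φ t p D g f)
  set u := u₀A κ Φ t p D g f
  set F := FcA κ Φ t p D g f yL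
  set R : ℤ := (KS0.R'0N κ Φ (KS.NQ Φ) t p D mk : ℤ)
  set Q : ℤ := (Neg.Kq κ : ℤ)
  set L := xBoxLoA (nL κ Φ t p D g f) qB (KS0.R'0N κ Φ (KS.NQ Φ) t p D mk) k
  set S := (shearUnit (nL κ Φ t p D g f) (hL κ Φ t p D g f) : ℤ) * (xBoxB (nL κ Φ t p D g f) (ℓL κ Φ t p D g f) (hL κ Φ t p D g f) (KS0.R'0N κ Φ (KS.NQ Φ) t p D mk) k + 1)
  set r : ℤ := ((fcellsA κ Φ t p D g f).r 0 : ℤ)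
  have hnm : 0 < n * m := mul_pos (by linarith) hm0
  have hum : 0 ≤ u * m := mul_nonneg (by linarith) hm0.le
  have p1 : n * m * ((5 * r + 10 * u * (j : ℤ) + 3 - lev) + F + 1) ≤ n * m * (4 - 10 * u + E + 3 * u + 1) := by
    refine mul_le_mul_of_nonneg_left ?_ hnm.le
    have : 10 * u * ((j : ℤ) + 1) = 10 * u * (j : ℤ) + 10 * u := by ring
    linarith
  have p2 : u * m * (-((qB : ℤ) + R + n)) ≤ u * m * L := mul_le_mul_of_nonneg_left hLo hum
  have p3 : n * m * E ≤ n * m * (2 * R) := mul_le_mul_of_nonneg_left hE hnm.le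
  have p4 : n * m * (6 * R + 11) ≤ n * m * u := mul_le_mul_of_nonneg_left hs0 hnm.le
  have p5 : u * m * (4 * (qB : ℤ)) ≤ u * m * n := mul_le_mul_of_nonneg_left hq' hum
  have p6 : u * m * (2000 * R) ≤ u * m * n := mul_le_mul_of_nonneg_left (by nlinarith) hum
  nlinarith [p1, p2, p3, p4, p5, p6, hsl, hnm, hum]

-- GEN-Q (R-2, captain 2026-08-27): `PlanarSkeletonFrmFrom.NegB.KS.FX2_XAR0` is not in the used cone of the node top — not ported.

-- GEN-Q (R-2, captain 2026-08-27): `PlanarSkeletonFrmFrom.NegB.KS.FX4_XAR0` is not in the used cone of the node top — not ported.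

end FloorsAX

end KS

end NegB

end PlanarSkeletonFrmQuasi

end Summit.CriticalPhenomena.PercolationContinuityZ3.Theorems.Transplant

end
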